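import Summits.QuantumFields.BalabanUV.Beta.EriceFlowEnclosureCesaroHigherOrder

/-!
# Beta / EriceFlowEnclosureCesaroHarmonicAverage — THE RG-TIME ∕ CUTOFF AVERAGE IS THE HARMONIC SCALE AVERAGE, AND IT CANNOT CREATE A
# DATUM EITHER: FOR A BOUNDED φ WITH CESÀRO MEAN M, `t·∫ₜᶜ M(s) ds∕s² → m ⟺ M(t) → m` AT 0⁺, WITH A ONE-SCALE REMAINDER ESTIMATE AND A
# SQUARE-ROOT LAW (pure [folklore] SERVICE; Mathlib + P2 #52a only)
# (β-flow team, prover 2 = lower ∕ positivity side, unit `b2b-balaban-beta-bflow-p2`, gen 35; module P2 #52f; no Erice sentence occurs)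

HONEST FRAMING (page 1 of everything the β sub-cell writes): discharging `BetaPertH` makes Bałaban's UV stability UNCONDITIONAL — a
real constructive-QFT result; it is NOT the continuum limit and NOT the Clay problem.  HONEST DEPENDENCY (cell reorg 2026-08-19,
verbatim): «continuum YM on T⁴ ⇐ BetaPertH ∧ nine spine estimates (0/9 proved); BetaPertH ⇐ (D1) ∧ (D4) ∧ CAP+tail; G-an2-4 gates
asym, D1 and NE2/3/4.»  THIS MODULE DISCHARGES NOTHING and quotes nothing: [folklore] real analysis about one bounded real function φ —
a Tauberian theorem of Schmidt type for the HARMONIC scale average `t·∫ₜᶜ M(s)s⁻² ds` of its Cesàro mean M (equivalently: the Cesàro mean AT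
INFINITY of `y ↦ M(1∕y)`), with remainder; no β-function occurs (the READING below is ours).

THE READING (why this average).  The lineage reads the three-loop datum m three ways — the order-g² letter of Λ at scale s = g² (rows
L84 ∕ L100), the running coupling's 1∕y letter at RG time τ with clock y ≍ |β₀|τ and s = 1∕y (rows L81 ∕ L107 ∕ L116), the bare
sequence's 1∕K letter at cutoff K with s = h_K ≍ 1∕(|β₀|K) (rows L91 ∕ L120) — and in each the deviation from the letter IS `(M(s) − m)∕|β₀|`
up to the printed-order remainder.  Averaging such a deviation UNIFORMLY IN RG TIME τ ≤ T, or UNIFORMLY OVER THE CUTOFFS K ≤ N, is (up to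
the clock's affine normalisation and the remainders) the Cesàro mean at infinity `(1∕Y)∫^Y M(1∕y)dy`, i.e. in the scale variable s = 1∕y
the HARMONIC average **`H_c(t) := t·∫ₜᶜ M(s) ds∕s²`** at t = 1∕Y — NOT the (C,2) mean `(1∕t)∫₀ᵗ M` of P2 #52a ∕ #52c (uniform in the
SCALE).  This file shows that the harmonic average is no better at manufacturing a datum: for |φ| ≤ C, **`H_c(t) → m ⟺ M(t) → m`**.

THE POINT.  M is 2C-log-Lipschitz (P2 #52a `cesaro_logLip`).  On the window [t, qt]: `H_c(t)∕t − H_c(qt)∕(qt) = ∫ₜ^{qt} M(s)s⁻² ds`, and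
`∫ₜ^{qt} M(s)s⁻² ds = M(t)·(q − 1)∕(qt) + R`, `|R| ≤ (2C log q)(q − 1)∕t` (crudely, `s⁻² ≤ t⁻²`), so
        **`|M(t) − (q·H_c(t) − H_c(qt))∕(q − 1)| ≤ 2Cq·log q`**        (`harmonic_one_scale`)
— the same one-scale shape as row L112 with the roles of the two means exchanged; hence `|M t − m| ≤ 2Cq log q + (q + 1)E∕(q − 1)` from a
uniform H-rate E (`harmonic_rate`), the square-root law `|M t − m| ≤ 4√(CE) + 3E` (`harmonic_sqrt_law`), and `H_c → m ⟹ M → m`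
(`cesaro_of_harmonic`); conversely `M → m ⟹ H_c → m` with the weight s⁻² integrated exactly (`harmonic_of_cesaro`), so
**`H_c → m ⟺ M → m`** (`harmonic_iff_cesaro`) — and by P2 #52a both ⟺ the (C,2) datum: uniform-in-scale and uniform-in-time averaging
agree on what they cannot do.

WHAT THIS FILE PROVES (0 sorry, 0 def): §1 `Mdivsq_continuousOn`, `Mdivsq_intervalIntegrable`, `inv_sq_integral`, HEADLINE
**`harmonic_one_scale`**; §2 **`harmonic_rate`**, **`harmonic_sqrt_law`**, **`cesaro_of_harmonic`**; §3 `harmonic_of_cesaro`,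
**`harmonic_iff_cesaro`**, `harmonic_iff_cesaro2` (all three averages carry one datum).
NOT CLAIMED: the kernel junction with the flow clock y(τ) of row L116 or with the cutoff points h_K of row L120 (the READING above is
verbal; the affine ∕ two-loop-clock normalisations are rows L107 ∕ L119); power-rate corollaries; anything about β-functions; `BetaPertH`;
continuum; Clay.
-/

namespace Summit.QuantumFields.BalabanUV.Beta.EriceFlowEnclosureCesaroHarmonicAverage

open Set Filter Topology MeasureTheory
open Summit.QuantumFields.BalabanUV.Beta.EriceFlowEnclosureCesaroHigherOrder
  (const_nonneg cesaro_abs_le cesaro_window_le cesaro_continuousOn cesaro2_iff_cesaro)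

noncomputable section

variable {φ : ℝ → ℝ} {δ C : ℝ}

/-! ## §1 The window identity and the one-scale estimate for the harmonic average -/

/-- `s ↦ M(s)∕s²` is continuous on ]0, δ] (M = Cesàro mean of φ, P2 #52a). [folklore] -/
theorem Mdivsq_continuousOn (hδ : 0 < δ) (hint : ∀ t ∈ Ioc 0 δ, IntervalIntegrable φ volume 0 t) :
    ContinuousOn (fun s => (∫ v in (0:ℝ)..s, φ v) / s / s ^ 2) (Ioc 0 δ) :=
  (cesaro_continuousOn hδ hint).div (continuousOn_id.pow 2) fun _ hs => pow_ne_zero 2 hs.1.ne'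

/-- `s ↦ M(s)∕s²` is interval-integrable on every [a, b] ⊆ ]0, δ]. [folklore] -/
theorem Mdivsq_intervalIntegrable (hδ : 0 < δ) (hint : ∀ t ∈ Ioc 0 δ, IntervalIntegrable φ volume 0 t)
    {a b : ℝ} (ha : 0 < a) (hab : a ≤ b) (hb : b ≤ δ) :
    IntervalIntegrable (fun s => (∫ v in (0:ℝ)..s, φ v) / s / s ^ 2) volume a b :=
  ((Mdivsq_continuousOn hδ hint).mono fun _ hs => ⟨ha.trans_le hs.1, hs.2.trans hb⟩).intervalIntegrable_of_Icc hab

/-- `∫ₜˣ s⁻² ds = t⁻¹ − x⁻¹` for `0 < t ≤ x` (antiderivative −s⁻¹). [folklore] -/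
theorem inv_sq_integral {t x : ℝ} (ht : 0 < t) (htx : t ≤ x) : ∫ s in t..x, (s ^ 2)⁻¹ = t⁻¹ - x⁻¹ := by
  have hderiv : ∀ s ∈ uIcc t x, HasDerivAt (fun s : ℝ => (-1) * s⁻¹) ((s ^ 2)⁻¹) s := by
    intro s hs
    rw [uIcc_of_le htx] at hs
    have hs0 : s ≠ 0 := (ht.trans_le hs.1).ne'
    exact ((hasDerivAt_inv hs0).const_mul (-1)).congr_deriv (by ring)
  have hcont : ContinuousOn (fun s : ℝ => (s ^ 2)⁻¹) (uIcc t x) := by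
    rw [uIcc_of_le htx]
    exact (continuousOn_id.pow 2).inv₀ fun s hs => pow_ne_zero 2 (ht.trans_le hs.1).ne'
  rw [intervalIntegral.integral_eq_sub_of_hasDerivAt hderiv hcont.intervalIntegrable]
  ring

/-- **THE ONE-SCALE ESTIMATE FOR THE HARMONIC AVERAGE (HEADLINE).**  φ interval-integrable with |φ| ≤ C on ]0, δ], M its Cesàro mean,
`H_c(t) = t·∫ₜᶜ M(s)s⁻² ds` (0 < t, 1 < q, qt ≤ c ≤ δ).  Then **`|M(t) − (q·H_c(t) − H_c(qt))∕(q − 1)| ≤ 2Cq·log q`**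
(`H_c(t)∕t − H_c(qt)∕(qt) = ∫ₜ^{qt} M s⁻²`, M within 2C log q of M(t) on the window, `s⁻² ≤ t⁻²`). [folklore] -/
theorem harmonic_one_scale (hδ : 0 < δ) (hint : ∀ t ∈ Ioc 0 δ, IntervalIntegrable φ volume 0 t)
    (hb : ∀ v ∈ Ioc 0 δ, |φ v| ≤ C) {c t q : ℝ} (ht : 0 < t) (hq : 1 < q) (hqt : q * t ≤ c) (hc : c ≤ δ) :
    |(∫ v in (0:ℝ)..t, φ v) / t
        - (q * (t * ∫ s in t..c, (∫ v in (0:ℝ)..s, φ v) / s / s ^ 2)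
            - (q * t) * ∫ s in (q * t)..c, (∫ v in (0:ℝ)..s, φ v) / s / s ^ 2) / (q - 1)|
      ≤ 2 * C * q * Real.log q := by
  have hC := const_nonneg hδ hb
  have hq0 : 0 < q := one_pos.trans hq
  have htq : t ≤ q * t := by nlinarith
  have htq' : t < q * t := by nlinarith
  have hqtδ : q * t ≤ δ := hqt.trans hc
  -- split ∫ₜᶜ = ∫ₜ^{qt} + ∫_{qt}ᶜ
  have hI1 := Mdivsq_intervalIntegrable hδ hint ht htq hqtδ
  have hI2 := Mdivsq_intervalIntegrable hδ hint (ht.trans htq') hqt hc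
  have hsplit := intervalIntegral.integral_add_adjacent_intervals hI1 hI2
  -- the window integral: ∫ₜ^{qt} M/s² = M t · (t⁻¹ − (qt)⁻¹) + R
  set R : ℝ := ∫ s in t..(q * t), ((∫ v in (0:ℝ)..s, φ v) / s / s ^ 2
      - (∫ v in (0:ℝ)..t, φ v) / t * (s ^ 2)⁻¹) with hR
  have hIconst : IntervalIntegrable (fun s : ℝ => (∫ v in (0:ℝ)..t, φ v) / t * (s ^ 2)⁻¹) volume t (q * t) := by
    refine ContinuousOn.intervalIntegrable_of_Icc htq (continuousOn_const.mul ?_)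
    exact (continuousOn_id.pow 2).inv₀ fun s hs => pow_ne_zero 2 (ht.trans_le hs.1).ne'
  have hwin : ∫ s in t..(q * t), (∫ v in (0:ℝ)..s, φ v) / s / s ^ 2
      = (∫ v in (0:ℝ)..t, φ v) / t * (t⁻¹ - (q * t)⁻¹) + R := by
    rw [hR, intervalIntegral.integral_sub hI1 hIconst, intervalIntegral.integral_const_mul, inv_sq_integral ht htq]
    ring
  -- |R| ≤ (2C log q / t²)·(qt − t)
  have hRb : |R| ≤ 2 * C * Real.log q / t ^ 2 * (q * t - t) := by
    have h := intervalIntegral.norm_integral_le_of_norm_le_const (a := t) (b := q * t) (C := 2 * C * Real.log q / t ^ 2)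
      (f := fun s => (∫ v in (0:ℝ)..s, φ v) / s / s ^ 2 - (∫ v in (0:ℝ)..t, φ v) / t * (s ^ 2)⁻¹) fun s hs => by
        rw [uIoc_of_le htq] at hs
        have hs0 : 0 < s := ht.trans hs.1
        have e : (∫ v in (0:ℝ)..s, φ v) / s / s ^ 2 - (∫ v in (0:ℝ)..t, φ v) / t * (s ^ 2)⁻¹
            = ((∫ v in (0:ℝ)..s, φ v) / s - (∫ v in (0:ℝ)..t, φ v) / t) / s ^ 2 := by
          field_simp
        rw [Real.norm_eq_abs, e, abs_div, abs_of_pos (pow_pos hs0 2)]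
        have hw := cesaro_window_le hint hb ht hs.1.le (hs.2.trans hqtδ)
        have hlog1 : 1 - t / s ≤ Real.log (s / t) := by
          have h' := Real.one_sub_inv_le_log_of_pos (div_pos hs0 ht)
          rwa [inv_div] at h'
        have hlog2 : Real.log (s / t) ≤ Real.log q :=
          Real.log_le_log (div_pos hs0 ht) ((div_le_iff₀ ht).mpr (by linarith [hs.2]))
        have h1 : |(∫ v in (0:ℝ)..s, φ v) / s - (∫ v in (0:ℝ)..t, φ v) / t| ≤ 2 * C * Real.log q :=
          hw.trans (mul_le_mul_of_nonneg_left (hlog1.trans hlog2) (by positivity))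
        have h2 : t ^ 2 ≤ s ^ 2 := pow_le_pow_left₀ ht.le hs.1.le 2
        calc _ ≤ 2 * C * Real.log q / s ^ 2 := div_le_div_of_nonneg_right h1 (pow_pos hs0 2).le
          _ ≤ 2 * C * Real.log q / t ^ 2 := by
              apply div_le_div_of_nonneg_left _ (pow_pos ht 2) h2
              exact mul_nonneg (by positivity) (Real.log_nonneg hq.le)
    rw [Real.norm_eq_abs, abs_of_nonneg (by nlinarith : (0:ℝ) ≤ q * t - t)] at h
    exact h
  -- assemble
  have hq1 : q - 1 ≠ 0 := (sub_pos.mpr hq).ne'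
  have e : (∫ v in (0:ℝ)..t, φ v) / t
        - (q * (t * ∫ s in t..c, (∫ v in (0:ℝ)..s, φ v) / s / s ^ 2)
            - (q * t) * ∫ s in (q * t)..c, (∫ v in (0:ℝ)..s, φ v) / s / s ^ 2) / (q - 1)
      = -(q * t / (q - 1)) * R := by
    have htne : t ≠ 0 := ht.ne'
    rw [← hsplit, hwin]
    field_simp
    ring
  rw [e, abs_mul, abs_neg, abs_of_pos (by positivity : (0:ℝ) < q * t / (q - 1))]
  calc q * t / (q - 1) * |R| ≤ q * t / (q - 1) * (2 * C * Real.log q / t ^ 2 * (q * t - t)) :=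
        mul_le_mul_of_nonneg_left hRb (by positivity)
    _ = 2 * C * q * Real.log q * ((q - 1) / (q - 1)) * (t ^ 2 / t ^ 2) := by ring
    _ = 2 * C * q * Real.log q := by rw [div_self hq1, div_self (pow_ne_zero 2 ht.ne'), mul_one, mul_one]

/-! ## §2 Tauberian direction: a rate for the harmonic average is a rate for M; H_c → m ⟹ M → m -/

/-- **ONE SCALE WITH A UNIFORM H-RATE**: if `|H_c(s) − m| ≤ E` for `s ∈ ]0, τ]` then for `0 < t`, `1 < q`, `qt ≤ τ`, `qt ≤ c ≤ δ`:
**`|M(t) − m| ≤ 2Cq·log q + (q + 1)E∕(q − 1)`**. [folklore] -/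
theorem harmonic_rate (hδ : 0 < δ) (hint : ∀ t ∈ Ioc 0 δ, IntervalIntegrable φ volume 0 t)
    (hb : ∀ v ∈ Ioc 0 δ, |φ v| ≤ C) {c τ E m : ℝ} (hc : c ≤ δ)
    (hE : ∀ s ∈ Ioc 0 τ, |s * (∫ σ in s..c, (∫ v in (0:ℝ)..σ, φ v) / σ / σ ^ 2) - m| ≤ E)
    {t q : ℝ} (ht : 0 < t) (hq : 1 < q) (hqτ : q * t ≤ τ) (hqc : q * t ≤ c) :
    |(∫ v in (0:ℝ)..t, φ v) / t - m| ≤ 2 * C * q * Real.log q + (q + 1) * E / (q - 1) := by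
  have h1 := harmonic_one_scale hδ hint hb ht hq hqc hc
  have hq0 : 0 < q := one_pos.trans hq
  have htq : t ≤ q * t := by nlinarith
  have hE1 := hE t ⟨ht, htq.trans hqτ⟩
  have hE2 := hE (q * t) ⟨by positivity, hqτ⟩
  have hq1 : 0 < q - 1 := sub_pos.mpr hq
  set H1 := t * ∫ s in t..c, (∫ v in (0:ℝ)..s, φ v) / s / s ^ 2 with hH1
  set H2 := (q * t) * ∫ s in (q * t)..c, (∫ v in (0:ℝ)..s, φ v) / s / s ^ 2 with hH2
  have e : (q * H1 - H2) / (q - 1) - m = (q * (H1 - m) - (H2 - m)) / (q - 1) := by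
    field_simp
    ring
  have h2 : |(q * H1 - H2) / (q - 1) - m| ≤ (q + 1) * E / (q - 1) := by
    rw [e, abs_div, abs_of_pos hq1, div_le_div_iff_of_pos_right hq1]
    calc |q * (H1 - m) - (H2 - m)| ≤ |q * (H1 - m)| + |H2 - m| := abs_sub _ _
      _ = q * |H1 - m| + |H2 - m| := by rw [abs_mul, abs_of_pos hq0]
      _ ≤ q * E + E := add_le_add (mul_le_mul_of_nonneg_left hE1 hq0.le) hE2
      _ = (q + 1) * E := by ring
  calc |(∫ v in (0:ℝ)..t, φ v) / t - m|
      = |((∫ v in (0:ℝ)..t, φ v) / t - (q * H1 - H2) / (q - 1)) + ((q * H1 - H2) / (q - 1) - m)| := by ring_nf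
    _ ≤ |(∫ v in (0:ℝ)..t, φ v) / t - (q * H1 - H2) / (q - 1)| + |(q * H1 - H2) / (q - 1) - m| := abs_add_le _ _
    _ ≤ _ := add_le_add h1 h2

/-- **THE SQUARE-ROOT LAW FOR THE HARMONIC AVERAGE**: with C > 0, E > 0 and the step h = √(E∕C) (q = 1 + h):
**`|M(t) − m| ≤ 4√(CE) + 3E`** whenever `(1 + √(E∕C))·t ≤ τ` and `≤ c` (`log(1 + h) ≤ h`, h² C = E). [folklore] -/
theorem harmonic_sqrt_law (hδ : 0 < δ) (hint : ∀ t ∈ Ioc 0 δ, IntervalIntegrable φ volume 0 t)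
    (hb : ∀ v ∈ Ioc 0 δ, |φ v| ≤ C) (hC : 0 < C) {c τ E m : ℝ} (hc : c ≤ δ)
    (hE : ∀ s ∈ Ioc 0 τ, |s * (∫ σ in s..c, (∫ v in (0:ℝ)..σ, φ v) / σ / σ ^ 2) - m| ≤ E) (hE0 : 0 < E)
    {t : ℝ} (ht : 0 < t) (hhτ : (1 + Real.sqrt (E / C)) * t ≤ τ) (hhc : (1 + Real.sqrt (E / C)) * t ≤ c) :
    |(∫ v in (0:ℝ)..t, φ v) / t - m| ≤ 4 * Real.sqrt (C * E) + 3 * E := by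
  obtain ⟨h, hh⟩ : ∃ h : ℝ, h = Real.sqrt (E / C) := ⟨_, rfl⟩
  rw [← hh] at hhτ hhc
  have hh0 : 0 < h := by rw [hh]; exact Real.sqrt_pos.mpr (div_pos hE0 hC)
  have hhsq : h ^ 2 = E / C := by rw [hh]; exact Real.sq_sqrt (div_pos hE0 hC).le
  have hq : 1 < 1 + h := by linarith
  have h1 := harmonic_rate hδ hint hb hc hE ht hq hhτ hhc
  have hlog : Real.log (1 + h) ≤ h := by
    have := Real.log_le_sub_one_of_pos (by linarith : (0:ℝ) < 1 + h)
    linarith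
  have hhne : h ≠ 0 := hh0.ne'
  have hE' : E = C * h ^ 2 := by rw [hhsq, mul_div_cancel₀ _ hC.ne']
  have hCE : Real.sqrt (C * E) = C * h := by
    rw [show C * E = (C * h) ^ 2 by rw [hE']; ring]
    exact Real.sqrt_sq (by positivity)
  have e1 : (1 + h + 1) * E / (1 + h - 1) = 2 * E / h + E := by
    rw [show (1:ℝ) + h + 1 = 2 + h by ring, show (1:ℝ) + h - 1 = h by ring, add_mul, add_div,
      mul_div_cancel_left₀ E hhne]
  rw [e1] at h1
  have h2 : 2 * C * (1 + h) * Real.log (1 + h) ≤ 2 * C * (1 + h) * h :=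
    mul_le_mul_of_nonneg_left hlog (by positivity)
  have h3 : 2 * E / h = 2 * C * h := by
    rw [hE', div_eq_iff hhne]
    ring
  rw [hCE]
  calc _ ≤ 2 * C * (1 + h) * Real.log (1 + h) + (2 * E / h + E) := h1
    _ ≤ 2 * C * (1 + h) * h + (2 * C * h + E) := by rw [h3]; linarith
    _ = 4 * (C * h) + 2 * (C * h ^ 2) + E := by ring
    _ = 4 * (C * h) + 3 * E := by rw [← hE']; ring

/-- **THE HARMONIC AVERAGE CANNOT CREATE A DATUM (Tauberian direction)**: for |φ| ≤ C, if `H_c(t) = t·∫ₜᶜ M s⁻² → m` at 0⁺ (0 < c ≤ δ)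
then `M(t) → m` at 0⁺. [folklore] -/
theorem cesaro_of_harmonic (hδ : 0 < δ) (hint : ∀ t ∈ Ioc 0 δ, IntervalIntegrable φ volume 0 t)
    (hb : ∀ v ∈ Ioc 0 δ, |φ v| ≤ C) {c m : ℝ} (hc0 : 0 < c) (hc : c ≤ δ)
    (hH : Tendsto (fun t => t * ∫ s in t..c, (∫ v in (0:ℝ)..s, φ v) / s / s ^ 2) (𝓝[>] 0) (𝓝 m)) :
    Tendsto (fun t => (∫ v in (0:ℝ)..t, φ v) / t) (𝓝[>] 0) (𝓝 m) := by
  have hC := const_nonneg hδ hb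
  -- work with the bound C + 1 > 0
  have hb' : ∀ v ∈ Ioc 0 δ, |φ v| ≤ C + 1 := fun v hv => (hb v hv).trans (by linarith)
  refine Metric.tendsto_nhds.mpr fun ε hε => ?_
  -- the step: q = 1 + η, 2(C+1) q log q ≤ 4(C+1) η ≤ ε/4
  obtain ⟨η, hη⟩ : ∃ η : ℝ, η = min 1 (ε / (16 * (C + 1))) := ⟨_, rfl⟩
  have hη0 : 0 < η := by rw [hη]; exact lt_min one_pos (by positivity)
  have hη1 : η ≤ 1 := by rw [hη]; exact min_le_left _ _
  have hηε : η ≤ ε / (16 * (C + 1)) := by rw [hη]; exact min_le_right _ _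
  have hq : 1 < 1 + η := by linarith
  have hstep : 2 * (C + 1) * (1 + η) * Real.log (1 + η) ≤ ε / 4 := by
    have hlog : Real.log (1 + η) ≤ η := by
      have := Real.log_le_sub_one_of_pos (by linarith : (0:ℝ) < 1 + η); linarith
    have h1 : 2 * (C + 1) * (1 + η) * Real.log (1 + η) ≤ 2 * (C + 1) * 2 * η := by
      calc _ ≤ 2 * (C + 1) * (1 + η) * η := mul_le_mul_of_nonneg_left hlog (by positivity)
        _ = (1 + η) * (2 * (C + 1) * η) := by ring
        _ ≤ 2 * (2 * (C + 1) * η) := mul_le_mul_of_nonneg_right (by linarith) (by positivity)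
        _ = 2 * (C + 1) * 2 * η := by ring
    have h2 : 2 * (C + 1) * 2 * η ≤ ε / 4 := by
      rw [le_div_iff₀ (by positivity)] at hηε
      linarith
    exact h1.trans h2
  -- the uniform H-rate E with (q+1)E/(q−1) ≤ ε/4
  obtain ⟨E, hEdef⟩ : ∃ E : ℝ, E = ε * η / (4 * (2 + η)) := ⟨_, rfl⟩
  have hE0 : 0 < E := by rw [hEdef]; positivity
  obtain ⟨τ, hτ, hball⟩ := Metric.tendsto_nhdsWithin_nhds.mp hH E hE0
  have hErate : ∀ s ∈ Ioc 0 (τ / 2), |s * (∫ σ in s..c, (∫ v in (0:ℝ)..σ, φ v) / σ / σ ^ 2) - m| ≤ E := by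
    intro s hs
    have h := hball (show s ∈ Ioi (0:ℝ) from hs.1) (by rw [Real.dist_eq, sub_zero, abs_of_pos hs.1]; linarith [hs.2])
    rw [Real.dist_eq] at h
    exact h.le
  have hfrac : (1 + η + 1) * E / (1 + η - 1) = ε / 4 := by
    have hηne : η ≠ 0 := hη0.ne'
    have h2η : (2 : ℝ) + η ≠ 0 := (by positivity : (0:ℝ) < 2 + η).ne'
    rw [show (1:ℝ) + η + 1 = 2 + η by ring, show (1:ℝ) + η - 1 = η by ring, hEdef, div_eq_iff hηne,
      mul_div_assoc', div_eq_iff (by positivity : (4:ℝ) * (2 + η) ≠ 0)]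
    ring
  -- conclusion on ]0, t₀[ with (1+η) t₀ ≤ min (τ/2) c
  set t₀ : ℝ := min (τ / 2) c / (1 + η) with ht₀
  have ht₀pos : 0 < t₀ := by positivity
  filter_upwards [Ioo_mem_nhdsGT ht₀pos] with t htm
  have ht0 : 0 < t := htm.1
  have hqt : (1 + η) * t ≤ min (τ / 2) c := by
    have := htm.2.le
    rw [ht₀, le_div_iff₀ (by positivity)] at this
    linarith
  have h := harmonic_rate hδ hint hb' hc hErate ht0 hq (hqt.trans (min_le_left _ _)) (hqt.trans (min_le_right _ _))
  rw [hfrac] at h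
  rw [Real.dist_eq]
  linarith

/-! ## §3 Abelian direction (no loss) and the equivalence -/

/-- **M → m ⟹ H_c → m** (no bound on φ needed beyond integrability: the weight s⁻² integrated exactly, `t·∫ₜ^τ ε s⁻² ≤ ε`; the tail
`t·∫_τᶜ M s⁻²` and `m·t∕τ` are O(t)). [folklore] -/
theorem harmonic_of_cesaro (hδ : 0 < δ) (hint : ∀ t ∈ Ioc 0 δ, IntervalIntegrable φ volume 0 t)
    {c m : ℝ} (hc0 : 0 < c) (hc : c ≤ δ)
    (hM : Tendsto (fun t => (∫ v in (0:ℝ)..t, φ v) / t) (𝓝[>] 0) (𝓝 m)) :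
    Tendsto (fun t => t * ∫ s in t..c, (∫ v in (0:ℝ)..s, φ v) / s / s ^ 2) (𝓝[>] 0) (𝓝 m) := by
  refine Metric.tendsto_nhds.mpr fun ε hε => ?_
  obtain ⟨τ₀, hτ₀, hball⟩ := Metric.tendsto_nhdsWithin_nhds.mp hM (ε / 2) (by positivity)
  set τ : ℝ := min (τ₀ / 2) c with hτ
  have hτpos : 0 < τ := lt_min (by positivity) hc0
  have hτc : τ ≤ c := min_le_right _ _
  have hnear : ∀ s ∈ Ioc 0 τ, |(∫ v in (0:ℝ)..s, φ v) / s - m| ≤ ε / 2 := by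
    intro s hs
    have h := hball (show s ∈ Ioi (0:ℝ) from hs.1)
      (by rw [Real.dist_eq, sub_zero, abs_of_pos hs.1]; linarith [hs.2, min_le_left (τ₀ / 2) c])
    rw [Real.dist_eq] at h
    exact h.le
  -- the fixed tail constant K := ∫_τᶜ M/s² and the bound: for t ≤ τ,
  --   H_c(t) − m = t·∫ₜ^τ (M − m)s⁻² + t·(K − m·(τ⁻¹ − c⁻¹)) − m·t·... ; we bound |H_c(t) − m| ≤ ε/2 + t·B
  set K : ℝ := ∫ s in τ..c, (∫ v in (0:ℝ)..s, φ v) / s / s ^ 2 with hK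
  set B : ℝ := |K| + |m| / τ with hB
  have hBound : ∀ t ∈ Ioc 0 τ, |t * (∫ s in t..c, (∫ v in (0:ℝ)..s, φ v) / s / s ^ 2) - m| ≤ ε / 2 + t * B := by
    intro t ht
    have ht0 : 0 < t := ht.1
    have hI1 := Mdivsq_intervalIntegrable hδ hint ht0 ht.2 (hτc.trans hc)
    have hI2 := Mdivsq_intervalIntegrable hδ hint hτpos hτc hc
    have hsplit := intervalIntegral.integral_add_adjacent_intervals hI1 hI2
    have hIw : IntervalIntegrable (fun s : ℝ => m * (s ^ 2)⁻¹) volume t τ := by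
      refine ContinuousOn.intervalIntegrable_of_Icc ht.2 (continuousOn_const.mul ?_)
      exact (continuousOn_id.pow 2).inv₀ fun s hs => pow_ne_zero 2 (ht0.trans_le hs.1).ne'
    -- ∫ₜ^τ M/s² = ∫ₜ^τ (M − m)/s² + m (t⁻¹ − τ⁻¹)
    have hwin : ∫ s in t..τ, (∫ v in (0:ℝ)..s, φ v) / s / s ^ 2
        = (∫ s in t..τ, ((∫ v in (0:ℝ)..s, φ v) / s / s ^ 2 - m * (s ^ 2)⁻¹)) + m * (t⁻¹ - τ⁻¹) := by
      rw [intervalIntegral.integral_sub hI1 hIw, intervalIntegral.integral_const_mul, inv_sq_integral ht0 ht.2]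
      ring
    -- weighted bound on the window: |∫ₜ^τ (M − m)/s²| ≤ (ε/2)(t⁻¹ − τ⁻¹)
    have hwb : |∫ s in t..τ, ((∫ v in (0:ℝ)..s, φ v) / s / s ^ 2 - m * (s ^ 2)⁻¹)| ≤ ε / 2 * (t⁻¹ - τ⁻¹) := by
      have hgi : IntervalIntegrable (fun s : ℝ => ε / 2 * (s ^ 2)⁻¹) volume t τ := by
        refine ContinuousOn.intervalIntegrable_of_Icc ht.2 (continuousOn_const.mul ?_)
        exact (continuousOn_id.pow 2).inv₀ fun s hs => pow_ne_zero 2 (ht0.trans_le hs.1).ne'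
      have h := intervalIntegral.norm_integral_le_of_norm_le (μ := volume)
        (f := fun s => (∫ v in (0:ℝ)..s, φ v) / s / s ^ 2 - m * (s ^ 2)⁻¹) ht.2 (Eventually.of_forall fun s hs => ?_) hgi
      · rw [intervalIntegral.integral_const_mul, inv_sq_integral ht0 ht.2] at h
        rw [← Real.norm_eq_abs]
        exact h
      · have hs0 : 0 < s := ht0.trans hs.1
        have e : (∫ v in (0:ℝ)..s, φ v) / s / s ^ 2 - m * (s ^ 2)⁻¹ = ((∫ v in (0:ℝ)..s, φ v) / s - m) / s ^ 2 := by
          field_simp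
        rw [Real.norm_eq_abs, e, abs_div, abs_of_pos (pow_pos hs0 2), div_eq_mul_inv]
        exact mul_le_mul_of_nonneg_right (hnear s ⟨hs0, hs.2⟩) (inv_nonneg.mpr (pow_pos hs0 2).le)
    have e : t * (∫ s in t..c, (∫ v in (0:ℝ)..s, φ v) / s / s ^ 2) - m
        = t * (∫ s in t..τ, ((∫ v in (0:ℝ)..s, φ v) / s / s ^ 2 - m * (s ^ 2)⁻¹)) + t * (K - m / τ) := by
      have htne : t ≠ 0 := ht0.ne'
      have hτne : τ ≠ 0 := hτpos.ne'
      rw [← hsplit, hwin]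
      have key : ∀ X : ℝ, t * (X + m * (t⁻¹ - τ⁻¹) + K) - m = t * X + t * (K - m / τ) := by
        intro X
        field_simp
        ring
      exact key _
    rw [e]
    have ht1 : t * (t⁻¹ - τ⁻¹) ≤ 1 := by
      rw [mul_sub, mul_inv_cancel₀ ht0.ne']
      have : 0 ≤ t * τ⁻¹ := by positivity
      linarith
    calc _ ≤ |t * ∫ s in t..τ, ((∫ v in (0:ℝ)..s, φ v) / s / s ^ 2 - m * (s ^ 2)⁻¹)| + |t * (K - m / τ)| := abs_add_le _ _
      _ = t * |∫ s in t..τ, ((∫ v in (0:ℝ)..s, φ v) / s / s ^ 2 - m * (s ^ 2)⁻¹)| + t * |K - m / τ| := by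
          rw [abs_mul, abs_mul, abs_of_pos ht0]
      _ ≤ t * (ε / 2 * (t⁻¹ - τ⁻¹)) + t * (|K| + |m| / τ) := by
          gcongr
          calc |K - m / τ| ≤ |K| + |m / τ| := abs_sub _ _
            _ = |K| + |m| / τ := by rw [abs_div, abs_of_pos hτpos]
      _ = ε / 2 * (t * (t⁻¹ - τ⁻¹)) + t * B := by rw [hB]; ring
      _ ≤ ε / 2 * 1 + t * B := by gcongr
      _ = ε / 2 + t * B := by ring
  have hBnn : 0 ≤ B := by positivity
  set t₀ : ℝ := min τ (ε / (2 * (B + 1))) with ht₀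
  have ht₀pos : 0 < t₀ := lt_min hτpos (by positivity)
  filter_upwards [Ioo_mem_nhdsGT ht₀pos] with t htm
  have ht0 : 0 < t := htm.1
  have htτ : t ≤ τ := htm.2.le.trans (min_le_left _ _)
  have htε : t < ε / (2 * (B + 1)) := htm.2.trans_le (min_le_right _ _)
  have h := hBound t ⟨ht0, htτ⟩
  have htB : t * B < ε / 2 := by
    rw [lt_div_iff₀ (by positivity)] at htε
    nlinarith
  rw [Real.dist_eq]
  linarith

/-- **THE HARMONIC (RG-TIME ∕ CUTOFF) AVERAGE AND THE CESÀRO MEAN HAVE THE SAME DATUM**: for |φ| ≤ C and 0 < c ≤ δ,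
`t·∫ₜᶜ M s⁻² → m ⟺ M(t) → m` at 0⁺ (and ⟺ the (C,2) datum, P2 #52a `cesaro2_iff_cesaro`). [folklore] -/
theorem harmonic_iff_cesaro (hδ : 0 < δ) (hint : ∀ t ∈ Ioc 0 δ, IntervalIntegrable φ volume 0 t)
    (hb : ∀ v ∈ Ioc 0 δ, |φ v| ≤ C) {c : ℝ} (hc0 : 0 < c) (hc : c ≤ δ) (m : ℝ) :
    Tendsto (fun t => t * ∫ s in t..c, (∫ v in (0:ℝ)..s, φ v) / s / s ^ 2) (𝓝[>] 0) (𝓝 m) ↔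
      Tendsto (fun t => (∫ v in (0:ℝ)..t, φ v) / t) (𝓝[>] 0) (𝓝 m) :=
  ⟨cesaro_of_harmonic hδ hint hb hc0 hc, harmonic_of_cesaro hδ hint hc0 hc⟩

/-- **ALL THREE AVERAGES CARRY ONE DATUM**: for |φ| ≤ C and 0 < c ≤ δ, the harmonic (RG-time ∕ cutoff) average and the (C,2)
(uniform-in-scale) average of M converge to the same m, namely iff M itself does (with P2 #52a `cesaro2_iff_cesaro`). [folklore] -/
theorem harmonic_iff_cesaro2 (hδ : 0 < δ) (hint : ∀ t ∈ Ioc 0 δ, IntervalIntegrable φ volume 0 t)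
    (hb : ∀ v ∈ Ioc 0 δ, |φ v| ≤ C) {c : ℝ} (hc0 : 0 < c) (hc : c ≤ δ) (m : ℝ) :
    Tendsto (fun t => t * ∫ s in t..c, (∫ v in (0:ℝ)..s, φ v) / s / s ^ 2) (𝓝[>] 0) (𝓝 m) ↔
      Tendsto (fun t => (∫ v in (0:ℝ)..t, (∫ w in (0:ℝ)..v, φ w) / v) / t) (𝓝[>] 0) (𝓝 m) := by
  rw [harmonic_iff_cesaro hδ hint hb hc0 hc, cesaro2_iff_cesaro hδ hint hb]

end

end Summit.QuantumFields.BalabanUV.Beta.EriceFlowEnclosureCesaroHarmonicAverage
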